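import Literature.MathematicalPhysics.QuantumLattice.DWaveSourceEnergyDensityRowReaders
import Literature.MathematicalPhysics.QuantumLattice.TIGroundEnergyDensityCouplingFamilies
import HarnessLib

/-!
# Two state classes, one dictionary: the grand-canonical torus-limit energy density `e_src(t',U,μ,h)`
# is the Legendre transform IN THE DENSITY of the canonical-class sourced energy density `E_ρ(t',U,h)`,
# at EVERY source `h`

Topic `Literature/MathematicalPhysics/QuantumLattice` (family `hubbard`); sequel of
`DWaveSourceEnergyDensityEnsembles.lean` (`e_src(t',U,μ,h) = dWaveSourceEnergyDensityTT' t' U μ h` is the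
infimum of the sourced mean energy over translation-invariant states) and of the model-free Legendre link of
`TIGroundEnergyDensityCouplingFamilies.lean` §9 (`e₀(Ψ − μn) = inf_ρ (e_ρ(Ψ) − μρ)` for every interaction `Ψ`).
Written for the pinning-field programme of the Hubbard cuprate cell (`hubbard-cq`), whose response-floor
chains run in TWO STATE CLASSES (cell rule «two state classes — never mix in one chord without the
`μ·(n − n₀)` term»):

* the GRAND-CANONICAL class at a certified chemical potential `μ`: all translation-invariant states, objective
  `E^{μ}_h(ω) = e^{1,t',U}(ω) − μρ(ω) − h·e_P(ω)`, value `e_src(t',U,μ,h)` (torus-limit object; SDP window rows,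
  grand-canonical trial states);
* the CANONICAL class at a fixed filling `ρ`: translation-invariant states of density `ρ`, objective
  `E^{0}_h(ω) = e^{1,t',U}(ω) − h·e_P(ω)`, value
  `E_ρ(t',U,h) := tiGroundEnergyDensityAt (hubbardTTPrimeSourcedInteraction 1 t' U 0 dWaveFormFactor h) 1 ρ`
  (canonical anchor rows such as node #473 at `h = 0`, cluster-mixture caps at density `7/8`).

This file types the conversion term once and for all:

* §1 the sourced interaction at `μ` IS the `μ`-pencil of the sourced interaction at `μ = 0`
  (`hubbardTTPrimeSourcedInteraction_eq_pencil_number`), so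
  `e_src(t',U,μ,h) = e₀(Ψ_h − μn)` with `Ψ_h` the `μ = 0` sourced interaction
  (`dWaveSourceEnergyDensityTT'_eq_tiGroundEnergyDensity_pencil_number`).
* §2 LEGENDRE AT EVERY FIELD: `e_src(t',U,μ,h) + μρ ≤ E_ρ(t',U,h)` for every realised density `ρ` (in particular
  every `ρ ∈ (0,2)`), and `e_src(t',U,μ,h) = inf_ρ (E_ρ(t',U,h) − μρ)` (`isGLB_…`).
* §3 CROSS-CLASS TRANSPORT (the certified `μ·ρ` bookkeeping): a grand-canonical sourced FLOOR `lo ≤ e_src(t',U,μ,h)`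
  (e.g. an SDP window row at `(μ, h)`, any side progression) is a canonical-class sourced floor
  `lo + μρ ≤ E_ρ(t',U,h)` at EVERY density and bounds `E^{0}_h(ω) ≥ lo + μρ` for every translation-invariant
  `ω` of density `ρ` — the LOWER slots at `h ± δ` of the canonical chain, which canonical certificates do not
  supply at `h ≠ 0`; conversely a canonical-class CAP `E_ρ(t',U,h) ≤ u` (or one translation-invariant trial
  state of density `ρ` with `E^{0}_h ≤ u`) is the grand-canonical cap `e_src(t',U,μ,h) ≤ u − μρ` at EVERY `μ`.

Everything is PROVED; no definition, no named fact. HONEST SCOPE: plumbing between two certified vocabularies;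
no number, no claim about any ground state.

## References
* D. Ruelle, *Statistical Mechanics: Rigorous Results* (1969), §3.4 (the grand-canonical function is the
  Legendre transform of the canonical one in the density). [cite: Ruelle1969, §3.4]
* R. B. Israel, *Convexity in the Theory of Lattice Gases* (1979), Thm. I.3.4. [cite: Israel1979, Thm. I.3.4]
* T. Koma, H. Tasaki, J. Stat. Phys. 76 (1994) 745, §1. [cite: KomaTasaki1994, §1]
-/

noncomputable section

namespace Literature.MathematicalPhysics.QuantumLattice

open _root_.Matrix Finset HubbardWave0 Literature.Probability.LatticeModels _root_.Filter ThermodynamicLimit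
open scoped _root_.Topology ComplexOrder BigOperators

/-! ### §1 The sourced interaction at `μ` is the `μ`-pencil of the sourced interaction at `μ = 0` -/

section Pencil

/-- **`Φ(t,t',U) − μn − hP_g = (Φ(t,t',U) − 0·n − hP_g) − μ·n`** as interactions (termwise bookkeeping).
[cite: KomaTasaki1994, §1] -/
theorem hubbardTTPrimeSourcedInteraction_eq_pencil_number (t t' U μ : ℝ) (g : Site 2 → ℝ) (h : ℝ) :
    hubbardTTPrimeSourcedInteraction t t' U μ g h =
      FermionInteraction.pencil (hubbardTTPrimeSourcedInteraction t t' U 0 g h) (numberInteraction 2) (-μ) := by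
  refine FermionInteraction.ext fun X => ?_
  simp only [hubbardTTPrimeSourcedInteraction, hubbardTTPrimeMuInteraction, FermionInteraction.pencil_apply,
    neg_zero, Complex.ofReal_zero, zero_smul, add_zero]
  abel

variable (t' U μ h : ℝ)

/-- **`e_src(t',U,μ,h) = e₀(Ψ_h − μn)`**, `Ψ_h = hubbardTTPrimeSourcedInteraction 1 t' U 0 dWaveFormFactor h` the
sourced interaction on the `μ = 0` pencil: the torus-limit energy density is the translation-invariant
variational minimum of the `μ`-pencil of the canonical-class objective. [cite: Ruelle1969, §3.4] -/
theorem dWaveSourceEnergyDensityTT'_eq_tiGroundEnergyDensity_pencil_number :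
    dWaveSourceEnergyDensityTT' t' U μ h =
      (FermionInteraction.pencil (hubbardTTPrimeSourcedInteraction 1 t' U 0 dWaveFormFactor h)
        (numberInteraction 2) (-μ)).tiGroundEnergyDensity 1 := by
  rw [dWaveSourceEnergyDensityTT'_eq_tiGroundEnergyDensity, ← hubbardTTPrimeSourcedInteraction_eq_pencil_number]

/-- The canonical-class objective is the grand-canonical one at `μ = 0`: for every state,
`E^{0}_h(ω) = e^{1,t',U}(ω) − h·e_P(ω)` and `E^{μ}_h(ω) = E^{0}_h(ω) − μρ(ω)`. [cite: KomaTasaki1994, §1] -/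
theorem InfVolFermionState.meanEnergy_sourced_eq_sourced_zero_sub_mul (ω : InfVolFermionState 2) :
    ω.meanEnergy (hubbardTTPrimeSourcedInteraction 1 t' U μ dWaveFormFactor h) 1 =
      ω.meanEnergy (hubbardTTPrimeSourcedInteraction 1 t' U 0 dWaveFormFactor h) 1 - μ * ω.density := by
  rw [InfVolFermionState.meanEnergy_hubbardTTPrimeSourced, InfVolFermionState.meanEnergy_hubbardTTPrimeSourced]
  ring

end Pencil

/-! ### §2 Legendre duality in the density at every field -/

section Legendre

variable (t' U μ h : ℝ)

/-- **Weak duality at every field**: `e_src(t',U,μ,h) + μρ ≤ E_ρ(t',U,h)` for every realised density `ρ` (a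
translation-invariant state of density `ρ` exists). [cite: Ruelle1969, §3.4] -/
theorem dWaveSourceEnergyDensityTT'_add_mul_le_tiGroundEnergyDensityAt {ρ : ℝ}
    (hne : ∃ ω : InfVolFermionState 2, ω.IsTranslationInvariant ∧ ω.density = ρ) :
    dWaveSourceEnergyDensityTT' t' U μ h + μ * ρ ≤
      (hubbardTTPrimeSourcedInteraction 1 t' U 0 dWaveFormFactor h).tiGroundEnergyDensityAt 1 ρ := by
  rw [dWaveSourceEnergyDensityTT'_eq_tiGroundEnergyDensity_pencil_number]
  exact FermionInteraction.tiGroundEnergyDensity_pencil_number_add_mul_le _ 1 μ hne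

/-- Interior-density form: `e_src(t',U,μ,h) + μρ ≤ E_ρ(t',U,h)` for every `ρ ∈ (0,2)`. [cite: Ruelle1969, §3.4] -/
theorem dWaveSourceEnergyDensityTT'_add_mul_le_tiGroundEnergyDensityAt_of_Ioo {ρ : ℝ} (hρ0 : 0 < ρ)
    (hρ2 : ρ < 2) :
    dWaveSourceEnergyDensityTT' t' U μ h + μ * ρ ≤
      (hubbardTTPrimeSourcedInteraction 1 t' U 0 dWaveFormFactor h).tiGroundEnergyDensityAt 1 ρ :=
  dWaveSourceEnergyDensityTT'_add_mul_le_tiGroundEnergyDensityAt t' U μ h (exists_isTranslationInvariant_density_eq hρ0 hρ2)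

/-- **Floors at all fillings recombine**: if `c + μρ ≤ E_ρ(t',U,h)` for every realised density `ρ`, then
`c ≤ e_src(t',U,μ,h)`. [cite: Ruelle1969, §3.4] -/
theorem le_dWaveSourceEnergyDensityTT'_of_forall_density_floor {c : ℝ}
    (hc : ∀ ρ : ℝ, (∃ ω : InfVolFermionState 2, ω.IsTranslationInvariant ∧ ω.density = ρ) →
      c + μ * ρ ≤ (hubbardTTPrimeSourcedInteraction 1 t' U 0 dWaveFormFactor h).tiGroundEnergyDensityAt 1 ρ) :
    c ≤ dWaveSourceEnergyDensityTT' t' U μ h := by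
  rw [dWaveSourceEnergyDensityTT'_eq_tiGroundEnergyDensity_pencil_number]
  exact FermionInteraction.le_tiGroundEnergyDensity_pencil_number _ 1 μ hc

/-- **LEGENDRE DUALITY AT EVERY FIELD**: `e_src(t',U,μ,h)` is the greatest lower bound of
`{E_ρ(t',U,h) − μρ : ρ realised}` — the grand-canonical torus-limit energy density is the concave conjugate in
the density of the canonical-class sourced energy density, source and all. [cite: Ruelle1969, §3.4] -/
theorem isGLB_tiGroundEnergyDensityAt_sub_mul_dWaveSourceEnergyDensityTT' :
    IsGLB {x : ℝ | ∃ ρ : ℝ, (∃ ω : InfVolFermionState 2, ω.IsTranslationInvariant ∧ ω.density = ρ) ∧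
        x = (hubbardTTPrimeSourcedInteraction 1 t' U 0 dWaveFormFactor h).tiGroundEnergyDensityAt 1 ρ - μ * ρ}
      (dWaveSourceEnergyDensityTT' t' U μ h) := by
  rw [dWaveSourceEnergyDensityTT'_eq_tiGroundEnergyDensity_pencil_number]
  exact FermionInteraction.isGLB_tiGroundEnergyDensity_sub_mul _ 1 μ

end Legendre

/-! ### §3 Cross-class transport: the certified `μ·ρ` bookkeeping -/

section Transport

variable (t' U μ h : ℝ)

/-- **Grand-canonical floor ⇒ canonical-class floor at every filling**: `lo ≤ e_src(t',U,μ,h)` gives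
`lo + μρ ≤ E_ρ(t',U,h)` for every realised density `ρ` — at `ρ = 7/8` a canonical-class SOURCED floor at the field
`h` from a grand-canonical certificate at `(μ, h)` (the lower slots at `h ± δ` of a canonical chord).
[cite: Ruelle1969, §3.4] -/
theorem tiGroundEnergyDensityAt_sourced_ge_of_le_dWaveSourceEnergyDensityTT' {lo : ℝ}
    (hlo : lo ≤ dWaveSourceEnergyDensityTT' t' U μ h) {ρ : ℝ}
    (hne : ∃ ω : InfVolFermionState 2, ω.IsTranslationInvariant ∧ ω.density = ρ) :
    lo + μ * ρ ≤ (hubbardTTPrimeSourcedInteraction 1 t' U 0 dWaveFormFactor h).tiGroundEnergyDensityAt 1 ρ := by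
  linarith [dWaveSourceEnergyDensityTT'_add_mul_le_tiGroundEnergyDensityAt t' U μ h hne]

/-- **State form**: `lo ≤ e_src(t',U,μ,h)` gives `lo + μρ(ω) ≤ E^{0}_h(ω)` for EVERY translation-invariant `ω`
(the `hlo` slot of the canonical-class bracket files, at any field, from a grand-canonical row).
[cite: Ruelle1969, §3.4] -/
theorem add_mul_density_le_meanEnergy_sourced_zero_of_le_dWaveSourceEnergyDensityTT' {lo : ℝ}
    (hlo : lo ≤ dWaveSourceEnergyDensityTT' t' U μ h) {ω : InfVolFermionState 2} (hω : ω.IsTranslationInvariant) :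
    lo + μ * ω.density ≤ ω.meanEnergy (hubbardTTPrimeSourcedInteraction 1 t' U 0 dWaveFormFactor h) 1 := by
  have h1 := hlo.trans (dWaveSourceEnergyDensityTT'_le_meanEnergy_sourced t' U μ h hω)
  rw [ω.meanEnergy_sourced_eq_sourced_zero_sub_mul] at h1
  linarith

/-- **Row form**: a grand-canonical torus FLOOR `lo·L² ≤ E₀(A_L(t',U,μ,h))` for every `L ≥ L₀` with `q ∣ L`
(`q ≥ 1`) gives `lo + μρ(ω) ≤ E^{0}_h(ω)` for every translation-invariant `ω` — a sourced SDP row at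
`(μ, h)` feeds the canonical chain at density `ρ(ω) = n₀` with the exact term `μn₀`. [cite: Ruelle1969, §3.4] -/
theorem add_mul_density_le_meanEnergy_sourced_zero_of_forall_dvd_groundEnergy_ge {lo : ℝ} {q L₀ : ℕ}
    (hq : 0 < q)
    (hrow : ∀ (L : ℕ) [NeZero L], L₀ ≤ L → q ∣ L →
      lo * (L : ℝ) ^ 2 ≤ (dWaveSourceTorusTT' L t' U μ h).groundEnergy)
    {ω : InfVolFermionState 2} (hω : ω.IsTranslationInvariant) :
    lo + μ * ω.density ≤ ω.meanEnergy (hubbardTTPrimeSourcedInteraction 1 t' U 0 dWaveFormFactor h) 1 :=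
  add_mul_density_le_meanEnergy_sourced_zero_of_le_dWaveSourceEnergyDensityTT' t' U μ h
    (dWaveSourceEnergyDensityTT'_ge_of_forall_dvd_le t' U μ h hq hrow) hω

/-- **Canonical-class cap ⇒ grand-canonical cap at every `μ`**: `E_ρ(t',U,h) ≤ u` at a realised density `ρ`
gives `e_src(t',U,μ,h) ≤ u − μρ`. [cite: Ruelle1969, §3.4] -/
theorem dWaveSourceEnergyDensityTT'_le_of_tiGroundEnergyDensityAt_le {ρ u : ℝ}
    (hne : ∃ ω : InfVolFermionState 2, ω.IsTranslationInvariant ∧ ω.density = ρ)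
    (hu : (hubbardTTPrimeSourcedInteraction 1 t' U 0 dWaveFormFactor h).tiGroundEnergyDensityAt 1 ρ ≤ u) :
    dWaveSourceEnergyDensityTT' t' U μ h ≤ u - μ * ρ := by
  linarith [dWaveSourceEnergyDensityTT'_add_mul_le_tiGroundEnergyDensityAt t' U μ h hne]

/-- **Trial-state form** (the `hcap` shape of the canonical chain): one translation-invariant `σ` of density `ρ`
with `E^{0}_h(σ) ≤ u` (e.g. a cluster mixture at density `7/8`) caps the grand-canonical torus-limit energy
density at every chemical potential: `e_src(t',U,μ,h) ≤ u − μρ`. [cite: Ruelle1969, §3.4] -/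
theorem dWaveSourceEnergyDensityTT'_le_of_meanEnergy_sourced_zero_le {σ : InfVolFermionState 2}
    (hσ : σ.IsTranslationInvariant) {ρ u : ℝ} (hρ : σ.density = ρ)
    (hu : σ.meanEnergy (hubbardTTPrimeSourcedInteraction 1 t' U 0 dWaveFormFactor h) 1 ≤ u) :
    dWaveSourceEnergyDensityTT' t' U μ h ≤ u - μ * ρ := by
  have h1 := dWaveSourceEnergyDensityTT'_le_meanEnergy_sourced t' U μ h hσ
  rw [σ.meanEnergy_sourced_eq_sourced_zero_sub_mul, hρ] at h1
  linarith

/-- **The same-density cancellation, torus-limit ground states.** If a torus limit `ω` of unit ground-state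
vectors of `A_L(t',U,μ,h)` (`h > 0`) happens to have density `ρ(ω) = ρ`, then a canonical-class floor
`c ≤ E_ρ(t',U,0)` at that density and field `0` (e.g. a canonical anchor) and a canonical-class cap
`E^{0}_h(σ) ≤ u` from ONE translation-invariant trial state `σ` of the same density give
`(c − u)/(2h) ≤ Re ω(P₀^d)` — the `μ`-terms cancel. [cite: KomaTasaki1994, §1] -/
theorem InfVolFermionState.IsTorusLimitOf.re_expect_localPairAt_ge_of_sameDensity_bounds
    {ω : InfVolFermionState 2} {ψ : ∀ L, Fock (Orb (FermionTorus 2 L))} {Ls : ℕ → ℕ}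
    [hL0 : ∀ j, NeZero (Ls j)] (hω : ω.IsTorusLimitOf ψ Ls) (hLs : Tendsto Ls atTop atTop)
    (hψ : ∀ j, star (ψ (Ls j)) ⬝ᵥ ψ (Ls j) = 1) {h : ℝ} (hh : 0 < h)
    (hgs : ∀ j, dWaveSourceTorusTT' (Ls j) t' U μ h *ᵥ ψ (Ls j) =
      ((Matrix.groundEnergy (dWaveSourceTorusTT' (Ls j) t' U μ h) : ℝ) : ℂ) • ψ (Ls j))
    {ρ c u : ℝ} (hρ : ω.density = ρ)
    (hc : c ≤ (hubbardTTPrimeSourcedInteraction 1 t' U 0 dWaveFormFactor 0).tiGroundEnergyDensityAt 1 ρ)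
    {σ : InfVolFermionState 2} (hσ : σ.IsTranslationInvariant) (hσρ : σ.density = ρ)
    (hu : σ.meanEnergy (hubbardTTPrimeSourcedInteraction 1 t' U 0 dWaveFormFactor h) 1 ≤ u) :
    (c - u) / (2 * h) ≤
      (ω.expect (pairRegion (insert (0 : Site 2) unitSteps) 0)
        (localPairAt (insert 0 unitSteps) dWaveFormFactor 0)).re := by
  -- the state's own grand-canonical energies at the fields `0` and `h`
  have hTI := hω.isTranslationInvariant
  have hmin := hω.meanEnergy_sourced_eq_dWaveSourceEnergyDensityTT' hLs hψ t' U μ h hgs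
  -- floor at field `0` for `ω` (density `ρ`): `c ≤ E^{0}_0(ω)`
  have hlo0 : c ≤ ω.meanEnergy (hubbardTTPrimeSourcedInteraction 1 t' U 0 dWaveFormFactor 0) 1 :=
    hc.trans (FermionInteraction.tiGroundEnergyDensityAt_le_meanEnergy _ 1 hTI hρ)
  -- cap at field `h` for `ω`: `E^{μ}_h(ω) = e_src(μ,h) ≤ u − μρ`, and `ρ(ω) = ρ`
  have hcap := dWaveSourceEnergyDensityTT'_le_of_meanEnergy_sourced_zero_le t' U μ h hσ hσρ hu
  have hcapω : ω.meanEnergy (hubbardTTPrimeSourcedInteraction 1 t' U 0 dWaveFormFactor h) 1 ≤ u := by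
    rw [ω.meanEnergy_sourced_eq_sourced_zero_sub_mul, hρ] at hmin
    linarith
  -- the Griffiths chord on the `μ = 0` pencil for `ω`, fields `0 < h`
  have hchord := ω.div_le_pairAmplitude_of_bounds (t := 1) (t' := t') (U := U) (μ := 0) (g := dWaveFormFactor)
    (h := h) (δ := h) hh (lo := c) (hi := u) (by rw [sub_self]; exact hlo0) hcapω
  rw [InfVolFermionState.meanEnergy_pairSourceInteraction_dWave_eq] at hchord
  rw [mul_comm, ← div_div]
  linarith

end Transport

end Literature.MathematicalPhysics.QuantumLattice

end
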